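import Summits.QuantumFields.BalabanUV.Beta.FP.PeriodisedSymCompositeIndexWardTwo

/-!
# `BalabanUV.Beta.FP.PeriodisedSymCompositeIndexWardTwoPure` — road «FP», row D1, ROUTE T, (J-a) (α) AT ORDER 2 ON THE AVERAGING SIDE: **THE `q2` WORD FOR THE
# ONE-SUMMAND COARSE BI-TABLE IS A CLEAN INDEX LAW** — the ♭ twin of `PeriodisedSymCompositeIndexWardTwo.torus_q2_sym_letter` (leaf-02 g22).

WHAT (`d = 3`, fine level `j`, coarse level `j+1`, `F = fine Lc M′`, `c = c_j = (Lc⁴·stepScale 3 Lc j)⁻¹`, `c′ = c_{j+1}`, `θ = stepScale (j+1)∕(stepScale j²·#B)`;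
`h′ := h + Dλ`): with the fine bi-table `Q₁₂ w w′ := −c • ΣΣ (w b·w′ b′) • Q₁₂^{b,b′}` (B1∕B2's border bi-member, U21's `hQ₁₂` VERBATIM) and the coarse bi-table
bound to the bi-member ALONE — **`hQ₂₂♭ : Q₂₂ w w′ = −c′ • Σ_{a′,a″} (w̄ a′·w̄′ a″) • Q₂₂^{a′,a″}`** (`w̄ = θ•Q₁₀ w`; U21's `hQ₂₂` WITHOUT its second summand
`Σ_{a′} (θ·((Q₁₁ w)·w′) a′) • Q₂₁^{a′}`) — the second-order similarity word of the composite `𝔔₂ := Q₂₂ h h·Q₁₀ + 2•Q₂₁ h·Q₁₁ h + Q₂₀·Q₁₂ h h` IS the same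
composite ALONG THE SHIFTED DIRECTION:
  §1 `q2_sim_word_pure` (pure algebra; `q2_sim_word` without the un-shifted rider `V`);
  §2 **`torus_q2_sym_letter_pure`**: `X̄X̄𝔔₀ + 2(X̄𝔔₁ + X̄𝔔₀X) + 𝔔₂ + 2𝔔₁X + 𝔔₀XX = Q₂₂ h′ h′ * Q₁₀ + Q₂₁ h′ * Q₁₁ h′ + (Q₂₁ h′ * Q₁₁ h′ + Q₂₀ * Q₁₂ h′ h′)` —
  NO un-shifted rider (the (★) of the two-summand letter is gone): the four SHIFT letters of the g22 file (`torus_symQ11_shift`, `torus_symQ21_shift`,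
  `torus_symQ12_shift`, `torus_symT22_shift`) fed to §1.
WHY (FINDING F-leaf02-g24-2, CLAIMS.log l.49852): with `hQ₂₂♭` the rows `c2` (T3), `d2` (`PeriodisedSymCoarseWardContactTwoPure.torus_d2_sym_pure`), the composite
Ward letter `b2` (`torus_b2_pure`) and this `q2` all hold BY TERM, so the level-0 door displays only `a1 a2 hdead hGt hfμ′ hcoarse′` + namings (U23♭).  Which binding
is the door of record is the OWNER's call — nothing of the dictionary asserted here.  [folklore] matrix algebra BY NAME; no `def`, no `def … : Prop`, nothing cited, 0 sorry.

HONEST DEPENDENCY (page 1, mandatory): continuum YM on T⁴ ⇐ BetaPertH ∧ nine spine estimates (0/9 proved); BetaPertH ⇐ (D1) ∧ (D4) ∧ CAP+tail;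
G-an2-4 gates asym, D1 and NE2/3/4.  HONEST FRAMING (cell contract, verbatim): «discharging `BetaPertH` makes Bałaban's UV stability UNCONDITIONAL —
a real constructive-QFT result; it is NOT the continuum limit and NOT the Clay problem.»  ABSOLUTE RULE (cell charter, verbatim): «No internally-minted
statement may enter as a cited fact. Every hypothesis is either kernel-proved in this package or a verbatim quotation of a PUBLISHED theorem with page
reference. The manuscript(s) under audit are NOT citable for their own disputed steps — they are the thing under adjudication; programme-internal
(2001/route/tribunal) claims are never citable.»  0 estimates; 0∕4 row-D1 binders; NOT (T-ID), NOT (J-a) complete, NOT SDF, NOT D1, NOT BetaPertH, NOT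
continuum, NOT Clay.  D1 formalisation swarm LEAF PROVER 02 (b2b-balaban-beta-d1-formalise-leaf-02 gen 24), 2026-08-23.  No existing file touched.
-/

noncomputable section
open scoped BigOperators
namespace Summit.QuantumFields.BalabanUV.Beta.FP.PeriodisedSymCompositeIndexWardTwoPure

open Finset Matrix
open Literature.MathematicalPhysics.QuantumFieldTheory.Balaban1983to89
open Literature.MathematicalPhysics.QuantumFieldTheory.Balaban1983to89.Beta
open B4TorusKernel.MultiPeriod (translate)
open ExpKernelCalculus (MKer)
open B5Prop11Plancherel (fine)
open B6Lemma24Torus (pbox mem_pbox)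
open AffineAveraging (Site box toSite)
open AveragingContoursRooted (ctr ctrOff ctrOff_mem_box)
open OneStepResolventKernel (Fib)
open Summit.QuantumFields.BalabanUV.Beta.BorderedHessian (stepScale stepScale_ne_zero)
open Summit.QuantumFields.BalabanUV.Beta.DshAn1 (Dsh)
open Summit.QuantumFields.BalabanUV.Beta.SymAveragingHessianCounts (symVhSAt)
open Summit.QuantumFields.BalabanUV.Beta.SymSecondOrderTablesAn1 (symVh₂SAn1)
open Summit.QuantumFields.BalabanUV.Beta.SymShiftedSpread (bhKStepSh)
open Summit.QuantumFields.BalabanUV.Beta.FP.KernelPeriodisationFib (Idx perF)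
open Summit.QuantumFields.BalabanUV.Beta.FP.KernelPeriodisationFibLoc (dper)
open Summit.QuantumFields.BalabanUV.Beta.FP.TorusGaugeCovariance (tdelta tgrad)
open Summit.QuantumFields.BalabanUV.Beta.FP.TorusGaugeCovarianceCoarse (coarsePt coarsePt_coe)
open Summit.QuantumFields.BalabanUV.Beta.FP.PeriodisedSymCompositeIndexWardTwo (torus_symQ11_shift torus_symQ21_shift torus_symQ12_shift torus_symT22_shift)

/-! ## §1 Pure algebra -/

section Algebra

/-- [folklore] **PURE ALGEBRA OF THE `q2` WORD, NO RIDER** (rectangular matrices: `P₀ P₁ T : κ × m`, `A B S : m × n`, `E : n × n`, `R : m × m`, `R′ : κ × κ`):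
with `X := −(c • E)`, `X̄ := c • R′`, the composite jets `𝔔₀ := P₀A`, `𝔔₁ := P₁A + P₀B`, `𝔔₂ := TA + P₁B + (P₁B + P₀S)` and the SHIFTED letters
`B′ = B + c•(RA − AE)`, `P₁′ = P₁ + c•(R′P₀ − P₀R)`, `S′ = S + c•((RB − BE) + (RB − BE) + c•(R(RA − AE) − (RA − AE)E))`,
`T′ = T + (c•(R′P₁ − P₁R) + c•(R′P₁ − P₁R)) + c•(R′(c•(R′P₀ − P₀R)) − (c•(R′P₀ − P₀R))R)`:
`X̄X̄𝔔₀ + (X̄𝔔₁ + X̄𝔔₀X) + ((X̄𝔔₁ + X̄𝔔₀X) + (𝔔₂ + 𝔔₁X + (𝔔₁X + 𝔔₀XX))) = T′A + P₁′B′ + (P₁′B′ + P₀S′)` — every piece shifted. -/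
theorem q2_sim_word_pure {κ m n : Type*} [Fintype κ] [Fintype m] [Fintype n] [DecidableEq κ] [DecidableEq m] [DecidableEq n]
    (P₀ P₁ T P₁' T' : Matrix κ m ℝ) (A B S B' S' : Matrix m n ℝ) (E : Matrix n n ℝ) (R : Matrix m m ℝ) (R' : Matrix κ κ ℝ) (c : ℝ)
    {X : Matrix n n ℝ} {Xbar : Matrix κ κ ℝ} (hX : X = -(c • E)) (hXbar : Xbar = c • R')
    (hB' : B' = B + c • (R * A - A * E)) (hP₁' : P₁' = P₁ + c • (R' * P₀ - P₀ * R))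
    (hS' : S' = S + c • ((R * B - B * E) + (R * B - B * E) + c • (R * (R * A - A * E) - (R * A - A * E) * E)))
    (hT' : T' = T + (c • (R' * P₁ - P₁ * R) + c • (R' * P₁ - P₁ * R)) + c • (R' * (c • (R' * P₀ - P₀ * R)) - (c • (R' * P₀ - P₀ * R)) * R)) :
    Xbar * Xbar * (P₀ * A) + (Xbar * (P₁ * A + P₀ * B) + Xbar * (P₀ * A) * X)
        + ((Xbar * (P₁ * A + P₀ * B) + Xbar * (P₀ * A) * X)
          + (T * A + P₁ * B + (P₁ * B + P₀ * S) + (P₁ * A + P₀ * B) * X + ((P₁ * A + P₀ * B) * X + P₀ * A * (X * X))))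
      = T' * A + P₁' * B' + (P₁' * B' + P₀ * S') := by
  subst hX hXbar hB' hP₁' hS' hT'
  simp only [Matrix.smul_mul, Matrix.mul_smul, smul_smul, smul_add, smul_sub, Matrix.mul_add, Matrix.add_mul, Matrix.mul_sub, Matrix.sub_mul,
    Matrix.mul_neg, Matrix.neg_mul, smul_neg, neg_neg, Matrix.mul_assoc]
  module

end Algebra

/-! ## §2 The `q2` word for the one-summand coarse bi-table at the (III′) torus door's types -/

section Letter

variable (M' : Fin 4 → ℕ) [∀ μ, NeZero (M' μ)] {Lc : ℕ} [NeZero Lc]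

/-- [folklore] **`torus_q2_sym_letter_pure` — THE SECOND-ORDER SIMILARITY WORD OF THE COMPOSITE, ONE-SUMMAND COARSE BI-TABLE: A CLEAN INDEX LAW** (fine level `j`,
coarse `j+1`; U21's `hX hXbar hQ₁₀ hQ₂₀ hQ₁₁ hQ₂₁ hW₁₂ hQ₁₂ hW₂₂` VERBATIM and **`hQ₂₂♭`** = the `−c_{j+1} •` bi-member along the transported directions ONLY; the
namings `h𝔔₀ h𝔔₁ h𝔔₂` as U21's with `Q₁₂ := Q₁₂ h h`, `Q₂₂ := Q₂₂ h h`): with `h′ := h + Dλ`,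
`X̄X̄𝔔₀ + (X̄𝔔₁ + X̄𝔔₀X) + ((X̄𝔔₁ + X̄𝔔₀X) + (𝔔₂ + 𝔔₁X + (𝔔₁X + 𝔔₀XX))) = Q₂₂ h′ h′ * Q₁₀ + Q₂₁ h′ * Q₁₁ h′ + (Q₂₁ h′ * Q₁₁ h′ + Q₂₀ * Q₁₂ h′ h′)` —
the four shift letters of `PeriodisedSymCompositeIndexWardTwo` fed to `q2_sim_word_pure`. -/
theorem torus_q2_sym_letter_pure (hM' : ∀ i, Lc ∣ M' i) (j : ℕ)
    (h : ↥(pbox (fine Lc M')) × Fin 4 → ℝ) (lam : ↥(pbox (fine Lc M')) → ℝ)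
    {κ : Type*} [Fintype κ] [DecidableEq κ] (pμ' : κ → ↥(pbox M')) (mμ' : κ → Fin 4)
    {Q₁₀ : Matrix (↥(pbox M') × Fin 4) (↥(pbox (fine Lc M')) × Fin 4) ℝ}
    (hQ₁₀ : Q₁₀ = (perF (fine Lc M') (bhKStepSh 3 Lc (Dsh Lc) j)).submatrix
        (fun a : ↥(pbox M') × Fin 4 => ((coarsePt M' Lc a.1, Sum.inr a.2) : Idx (fine Lc M') (Fib 3)))
        (fun b : ↥(pbox (fine Lc M')) × Fin 4 => ((b.1, Sum.inl b.2) : Idx (fine Lc M') (Fib 3))))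
    {Q₂₀ : Matrix κ (↥(pbox M') × Fin 4) ℝ}
    (hQ₂₀ : Q₂₀ = (perF M' (bhKStepSh 3 Lc (Dsh Lc) (j + 1))).submatrix (fun a : κ => ((pμ' a, Sum.inr (mμ' a)) : Idx M' (Fib 3)))
        (fun b : ↥(pbox M') × Fin 4 => ((b.1, Sum.inl b.2) : Idx M' (Fib 3))))
    (Q₁₁ : (↥(pbox (fine Lc M')) × Fin 4 → ℝ) → Matrix (↥(pbox M') × Fin 4) (↥(pbox (fine Lc M')) × Fin 4) ℝ)
    (hQ₁₁ : ∀ w, Q₁₁ w = ∑ b : ↥(pbox (fine Lc M')) × Fin 4, w b •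
        (perF (fine Lc M') (dper (fine Lc M') (symVhSAt (ctr 4 Lc) 3 Lc rfl b.2 (b.1 : Site 4)))).submatrix
          (fun a : ↥(pbox M') × Fin 4 => ((coarsePt M' Lc a.1, Sum.inr a.2) : Idx (fine Lc M') (Fib 3)))
          (fun b : ↥(pbox (fine Lc M')) × Fin 4 => ((b.1, Sum.inl b.2) : Idx (fine Lc M') (Fib 3))))
    (Q₂₁ : (↥(pbox (fine Lc M')) × Fin 4 → ℝ) → Matrix κ (↥(pbox M') × Fin 4) ℝ)
    (hQ₂₁ : ∀ w, Q₂₁ w = ∑ b : ↥(pbox (fine Lc M')) × Fin 4, w b •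
        ∑ a' : ↥(pbox M') × Fin 4, ((stepScale 3 Lc (j + 1) / (stepScale 3 Lc j ^ 2 * ((box (3 + 1) Lc).card : ℝ))) * Q₁₀ a' b) •
          (perF M' (dper M' (symVhSAt (ctr 4 Lc) 3 Lc rfl a'.2 (a'.1 : Site 4)))).submatrix (fun a : κ => ((pμ' a, Sum.inr (mμ' a)) : Idx M' (Fib 3)))
            (fun b : ↥(pbox M') × Fin 4 => ((b.1, Sum.inl b.2) : Idx M' (Fib 3))))
    -- ORDER 2: the second-bond-periodised border bi-families on `F` (fine) and on `M′` (coarse); the coarse table is the bi-member ALONE (♭)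
    {W₁₂ : Fin 4 → Site 4 → Fin 4 → Site 4 → MKer 4 (Fib 3)}
    (hW₁₂ : W₁₂ = fun κ' u' κ u x z a c => ∑' n : Site 4, symVh₂SAn1 3 Lc κ u κ' (translate (fine Lc M') u' n) x z a c)
    (Q₁₂ : (↥(pbox (fine Lc M')) × Fin 4 → ℝ) → (↥(pbox (fine Lc M')) × Fin 4 → ℝ) → Matrix (↥(pbox M') × Fin 4) (↥(pbox (fine Lc M')) × Fin 4) ℝ)
    (hQ₁₂ : ∀ w w', Q₁₂ w w' = -(((Lc : ℝ) ^ (3 + 1) * stepScale 3 Lc j)⁻¹) • ∑ b : ↥(pbox (fine Lc M')) × Fin 4, ∑ b' : ↥(pbox (fine Lc M')) × Fin 4, (w b * w' b') •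
        (perF (fine Lc M') (dper (fine Lc M') (W₁₂ b'.2 (b'.1 : Site 4) b.2 (b.1 : Site 4)))).submatrix
          (fun a : ↥(pbox M') × Fin 4 => ((coarsePt M' Lc a.1, Sum.inr a.2) : Idx (fine Lc M') (Fib 3)))
          (fun c : ↥(pbox (fine Lc M')) × Fin 4 => ((c.1, Sum.inl c.2) : Idx (fine Lc M') (Fib 3))))
    {W₂₂ : Fin 4 → Site 4 → Fin 4 → Site 4 → MKer 4 (Fib 3)}
    (hW₂₂ : W₂₂ = fun κ' u' κ u x z a c => ∑' n : Site 4, symVh₂SAn1 3 Lc κ u κ' (translate M' u' n) x z a c)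
    (Q₂₂ : (↥(pbox (fine Lc M')) × Fin 4 → ℝ) → (↥(pbox (fine Lc M')) × Fin 4 → ℝ) → Matrix κ (↥(pbox M') × Fin 4) ℝ)
    (hQ₂₂ : ∀ w w', Q₂₂ w w' = -(((Lc : ℝ) ^ (3 + 1) * stepScale 3 Lc (j + 1))⁻¹) • (∑ a' : ↥(pbox M') × Fin 4, ∑ a'' : ↥(pbox M') × Fin 4,
          (((stepScale 3 Lc (j + 1) / (stepScale 3 Lc j ^ 2 * ((box (3 + 1) Lc).card : ℝ))) * ∑ b : ↥(pbox (fine Lc M')) × Fin 4, Q₁₀ a' b * w b) * ((stepScale 3 Lc (j + 1) / (stepScale 3 Lc j ^ 2 * ((box (3 + 1) Lc).card : ℝ))) * ∑ b : ↥(pbox (fine Lc M')) × Fin 4, Q₁₀ a'' b * w' b)) •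
            (perF M' (dper M' (W₂₂ a''.2 (a''.1 : Site 4) a'.2 (a'.1 : Site 4)))).submatrix (fun a : κ => ((pμ' a, Sum.inr (mμ' a)) : Idx M' (Fib 3)))
            (fun b : ↥(pbox M') × Fin 4 => ((b.1, Sum.inl b.2) : Idx M' (Fib 3)))))
    -- the chart transports (U18's `hX hXbar` at `d = 3`, level `j`)
    {X : Matrix (↥(pbox (fine Lc M')) × Fin 4) (↥(pbox (fine Lc M')) × Fin 4) ℝ} {Xbar : Matrix κ κ ℝ}
    (hX : X = -((((Lc : ℝ) ^ (3 + 1) * stepScale 3 Lc j)⁻¹) • Matrix.diagonal (fun b : ↥(pbox (fine Lc M')) × Fin 4 => lam b.1)))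
    (hXbar : Xbar = (((Lc : ℝ) ^ (3 + 1) * stepScale 3 Lc j)⁻¹) •
        Matrix.diagonal (fun α : κ => ∑ t : ↥(pbox M'), tdelta M' ((pμ' α : Site 4) + ctr 4 Lc) t
              * (∑ s : ↥(pbox (fine Lc M')), tdelta (fine Lc M') ((Lc : ℤ) • (t : Site 4) + ctr 4 Lc) s * lam s)))
    -- the composite jets NAMED (U18's `h𝔔₀ h𝔔₁ h𝔔₂` with `Q₁₂ := Q₁₂ h h`, `Q₂₂ := Q₂₂ h h`)
    {𝔔₀ 𝔔₁ 𝔔₂ : Matrix κ (↥(pbox (fine Lc M')) × Fin 4) ℝ} (h𝔔₀ : Q₂₀ * Q₁₀ = 𝔔₀) (h𝔔₁ : Q₂₁ h * Q₁₀ + Q₂₀ * Q₁₁ h = 𝔔₁)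
    (h𝔔₂ : Q₂₂ h h * Q₁₀ + Q₂₁ h * Q₁₁ h + (Q₂₁ h * Q₁₁ h + Q₂₀ * Q₁₂ h h) = 𝔔₂) :
    Xbar * Xbar * 𝔔₀ + (Xbar * 𝔔₁ + Xbar * 𝔔₀ * X) + ((Xbar * 𝔔₁ + Xbar * 𝔔₀ * X) + (𝔔₂ + 𝔔₁ * X + (𝔔₁ * X + 𝔔₀ * (X * X))))
      = Q₂₂ (fun b => h b + ∑ s : ↥(pbox (fine Lc M')), tgrad (fine Lc M') (b.1, Sum.inl b.2) s * lam s) (fun b => h b + ∑ s : ↥(pbox (fine Lc M')), tgrad (fine Lc M') (b.1, Sum.inl b.2) s * lam s) * Q₁₀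
        + Q₂₁ (fun b => h b + ∑ s : ↥(pbox (fine Lc M')), tgrad (fine Lc M') (b.1, Sum.inl b.2) s * lam s) * Q₁₁ (fun b => h b + ∑ s : ↥(pbox (fine Lc M')), tgrad (fine Lc M') (b.1, Sum.inl b.2) s * lam s)
        + (Q₂₁ (fun b => h b + ∑ s : ↥(pbox (fine Lc M')), tgrad (fine Lc M') (b.1, Sum.inl b.2) s * lam s) * Q₁₁ (fun b => h b + ∑ s : ↥(pbox (fine Lc M')), tgrad (fine Lc M') (b.1, Sum.inl b.2) s * lam s)
          + Q₂₀ * Q₁₂ (fun b => h b + ∑ s : ↥(pbox (fine Lc M')), tgrad (fine Lc M') (b.1, Sum.inl b.2) s * lam s) (fun b => h b + ∑ s : ↥(pbox (fine Lc M')), tgrad (fine Lc M') (b.1, Sum.inl b.2) s * lam s)) := by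
  subst h𝔔₀ h𝔔₁ h𝔔₂
  rw [hQ₂₂ h h, hQ₂₂ (fun b => h b + ∑ s : ↥(pbox (fine Lc M')), tgrad (fine Lc M') (b.1, Sum.inl b.2) s * lam s)]
  exact q2_sim_word_pure Q₂₀ (Q₂₁ h) _ _ _ Q₁₀ (Q₁₁ h) (Q₁₂ h h) _ _ _ _ _ (((Lc : ℝ) ^ (3 + 1) * stepScale 3 Lc j)⁻¹) hX hXbar
    (torus_symQ11_shift M' j h lam hQ₁₀ Q₁₁ hQ₁₁)
    (torus_symQ21_shift M' hM' j h lam pμ' mμ' hQ₁₀ hQ₂₀ Q₂₁ hQ₂₁)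
    (torus_symQ12_shift M' j h lam hQ₁₀ Q₁₁ hQ₁₁ hW₁₂ Q₁₂ hQ₁₂)
    (torus_symT22_shift M' hM' j h lam pμ' mμ' hQ₁₀ hQ₂₀ Q₂₁ hQ₂₁ hW₂₂)

end Letter

end Summit.QuantumFields.BalabanUV.Beta.FP.PeriodisedSymCompositeIndexWardTwoPure

end
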